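import Literature.MathematicalPhysics.QuantumChemistry.GroupLocalCrossFormBound
import Summits.Ventures.CertifiedQuantumChemistry.Rows.SingletDeflatorLocalRows
import HarnessLib

/-!
# Ventures/CertifiedQuantumChemistry — Rows/SingletDeflatorLocalCrossRows.lean: the (n2)-hoff kernel
# discharge for deflators with INTER-GROUP DENSITY–DENSITY terms (door M1-OS, β_X of record)

HONEST FRAMING (verbatim): certified bounds for a stated model Hamiltonian in a stated basis; not a
claim about the real molecule or material beyond that model. WHAT THIS FILE IS NOT: no number, no row,
no certificate; soundness lemmas only — every premise below is either kernel-decidable on literal tables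
(`hh`, `hg`, `hx`, `htab`, `huT`, the uniform-density tops `hUpoly`) or a reader-side certificate
statement (`hU` local tops of the non-polynomial groups, `htop`/`htopPen`, the lower-row leg `hL`).

Sibling of `Rows/SingletDeflatorLocalRows.lean` (p497211/p497812, chem-type-02): there the deflator
file `S` has group-LOCAL tables (`(pq|rs) ≠ 0 ⇒ q, r, s ~ p`) and the finite occupation table `htab`
reads `S.ecore + Σ_i U_i(l_i) ≤ c`. The β OF RECORD of the cell's door M1-OS Temple row (chem-lead A40
(6), chem-ref-1 RC.205) is idea-2's `β_X` with the deflator `X = P(ĥ, v̂) − κ·Ĥ_MAG^fc`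
(DESIGN-M1OS (0.1)), `P` a QUADRATIC polynomial in the DOCC-hole count `ĥ` and the VIRT-particle count
`v̂` with a cross term `f·ĥ·v̂`: its file `F_X` carries inter-group density–density entries `(dd|aa)`,
`d ∈ DOCC`, `a ∈ VIRT`, so the local sibling does not apply (chem-ref-4 batch #36 READING (ii)). With
`Literature/…/GroupLocalCrossFormBound.lean` (`groupLocalCross_form_le`) the same kernel discharge goes
through when every non-zero two-electron entry of `S` is group-local OR a diagonal density pair and the
inter-group diagonal density entries are group-pair constants `b×(i, j)`: the table becomes
`S.ecore + Σ_i U_i(l_i) + ½ Σ_{i≠j} b×(i,j) l_i l_j ≤ c` (`Model.form_le_of_localCrossBounds`,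
`Model.deflator_form_le_on_singlet_orth_of_localCrossBounds{,_spinPenalty}`,
`Model.singletGapCertificateCodimOne_of_localCrossDeflator{,_singlet,_spinPenalty,_spinPenalty_singlet}`),
and a group whose OWN restricted tables are a uniform number polynomial (`h = α[p=q]`,
`(pq|rs) = β[q=p][s=r]`) has the EXACT local top `αN + ½β(N² − N)` (`Model.localTop_of_uniformDensity`,
the kernel discharge of `hU` for the DOCC and VIRT groups of `F_X`). For RC.205's instance: groups
DOCC/MAG/VIRT (`m = (4, 8, 4)`), `t = (8, 8, 0)`, `n = 8`, the 80 classes `(h, v) ≠ (0, 0)` of the class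
check are exactly the `l ≠ t` of `htab`; reader-side remain the 17 MAG certificates (`U_MAG(k′)`), the
`k′ = 8` top-class certificate (`htop`/`htopPen`) and the flip leg `hL`. Nothing here asserts any of them.

References: chem-type-09 `singletGapCertificateCodimOne_of_{lowerRow,singletLowerRow}_shift`
(p490432); chem-type-02 `Model.deflator_form_le_on_singlet_orth_of_groups` (p491858), `Model.restrict`
(p497211), `groupLocalCross_form_le` / `uniformDensity_form_eq` (GroupLocalCrossFormBound.lean);
Verstichel et al., J. Chem. Phys. 132 (2010) 114113, §2.3; Horn–Johnson (2013) Cor. 4.3.9 (rank-one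
deflation, through the imported producer); Helgaker–Jørgensen–Olsen (2000) eqs. (2.2.7), (2.2.16).
-/

noncomputable section

namespace Summit.Ventures.CertifiedQuantumChemistry

open Matrix Finset
open Literature.MathematicalPhysics.QuantumLattice Literature.MathematicalPhysics.QuantumChemistry
open scoped ComplexOrder

variable {k : ℕ}

/-- **Exact local top of a uniform-density group (kernel discharge of `hU`).** If a file `T : Model m`
(typically a group restriction `S.restrict (φ i)`) has tables `h_pq = α[p = q]`,
`(pq|rs) = β[q = p][s = r]` and scalar `0`, then on every `(a, b)` sector vector `χ`,
`Re⟨χ, Ĥ(T)χ⟩ ≤ (αN + ½β(N² − N))‖χ‖²`, `N = a + b` (with equality; `uniformDensity_form_eq`).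
[cite: HelgakerJorgensenOlsen2000, eq. (2.2.16)] -/
theorem Model.localTop_of_uniformDensity {m : ℕ} (T : Model m) (α β : ℚ)
    (hh : ∀ p q, T.h p q = if p = q then α else 0)
    (hg : ∀ p q r s, T.eri p q r s = if q = p ∧ s = r then β else 0) (hc : T.ecore = 0)
    {a b : ℕ} (χ : Fock (Orb (Fin m))) (hχ : IsInSector a b χ) :
    (star χ ⬝ᵥ T.hamiltonian *ᵥ χ).re ≤
      ((α * (a + b : ℕ) + 1 / 2 * β * (((a + b : ℕ) : ℚ) ^ 2 - (a + b : ℕ)) : ℚ) : ℝ) *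
        (star χ ⬝ᵥ χ).re := by
  have hH : T.hamiltonian = molecularHamiltonian (fun p q : Fin m => if p = q then (α : ℂ) else 0)
      (fun p q r s : Fin m => if q = p ∧ s = r then (β : ℂ) else 0) 0 := by
    unfold Model.hamiltonian
    congr 1
    · funext p q
      rw [hh]
      split_ifs <;> simp only [Rat.cast_zero]
    · funext p q r s
      rw [hg]
      split_ifs <;> simp only [Rat.cast_zero]
    · rw [hc, Rat.cast_zero]
  rw [hH, uniformDensity_form_eq _ _ _ hχ]
  refine le_of_eq ?_
  congr 1
  have hq : ((0 : ℂ) + (α : ℂ) * ((a + b : ℕ) : ℂ) +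
      (1 / 2 : ℂ) * (β : ℂ) * (((a + b : ℕ) : ℂ) ^ 2 - ((a + b : ℕ) : ℂ))) =
      (((α * (a + b : ℕ) + 1 / 2 * β * (((a + b : ℕ) : ℚ) ^ 2 - (a + b : ℕ)) : ℚ) : ℝ) : ℂ) := by
    push_cast
    ring
  rw [hq, Complex.ofReal_re]

/-- **The tensor-block bound with inter-group density terms at a model.** For a file `S` whose
non-zero two-electron entries are group-local or diagonal density pairs, with inter-group diagonal
density entries the group-pair constants `b×` (`hx`), and local occupation-resolved tops `U_i` (`hU`,
on the groups' own Fock spaces), on every occupation class `l`: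
`Re⟨z, Ĥ(S) z⟩ ≤ (S.ecore + Σ_i U_i(l_i) + ½ Σ_{i≠j} b×(i,j) l_i l_j)·‖z‖²`
(`groupLocalCross_form_le` at the cast tables). [cite: VerstichelEtAl2010Subsystem, §2.3 eqs. (16)-(24)] -/
theorem Model.form_le_of_localCrossBounds {X : Type*} [Fintype X] [DecidableEq X] (grp : Fin k → X)
    (m : X → ℕ) (φ : ∀ i, Fin (m i) ↪o Fin k) (hφ : ∀ i j, grp (φ i j) = i)
    (hcov : ∀ i p, grp p = i → ∃ j, φ i j = p) (S : Model k)
    (hh : ∀ p q, S.h p q ≠ 0 → grp q = grp p)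
    (hg : ∀ p q r s, S.eri p q r s ≠ 0 →
      (grp q = grp p ∧ grp r = grp p ∧ grp s = grp p) ∨ (q = p ∧ s = r))
    (bx : X → X → ℚ) (hx : ∀ p r, grp r ≠ grp p → S.eri p p r r = bx (grp p) (grp r))
    (U : X → ℕ → ℚ)
    (hU : ∀ i a b (χ : Fock (Orb (Fin (m i)))), IsInSector a b χ →
      (star χ ⬝ᵥ (S.restrict (φ i)).hamiltonian *ᵥ χ).re ≤ ((U i (a + b) : ℚ) : ℝ) * (star χ ⬝ᵥ χ).re)
    (l : X → ℕ) (z : Fock (Orb (Fin k)))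
    (hz : ∀ s, (fun i => ((upPart s).filter (fun p => grp p = i)).card +
      ((downPart s).filter (fun p => grp p = i)).card) ≠ l → z s = 0) :
    (star z ⬝ᵥ S.hamiltonian *ᵥ z).re ≤
      ((S.ecore + ∑ i, U i (l i) +
        1 / 2 * ∑ i, ∑ j, (if i ≠ j then bx i j * ((l i : ℚ) * (l j : ℚ)) else 0) : ℚ) : ℝ) *
        (star z ⬝ᵥ z).re := by
  have h := groupLocalCross_form_le grp m φ hφ hcov (fun p q => (S.h p q : ℂ))
    (fun p q r s => (S.eri p q r s : ℂ)) (S.ecore : ℂ) (fun i j => (bx i j : ℂ))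
    (fun p q hpq => hh p q fun h0 => hpq (by rw [h0, Rat.cast_zero]))
    (fun p q r s hpqrs => hg p q r s fun h0 => hpqrs (by rw [h0, Rat.cast_zero]))
    (fun p r hpr => by rw [hx p r hpr])
    (fun i N => ((U i N : ℚ) : ℝ)) (fun i a b χ hχ => by
      have h1 := hU i a b χ hχ
      rwa [Model.hamiltonian_restrict] at h1) l z hz
  have hre : ((S.ecore : ℚ) : ℂ).re = ((S.ecore : ℚ) : ℝ) := by
    rw [← Complex.ofReal_ratCast, Complex.ofReal_re]
  have hκ : ((1 / 2 : ℂ) * ∑ i, ∑ j, if i ≠ j then (bx i j : ℂ) * (((l i : ℕ) : ℂ) * ((l j : ℕ) : ℂ)) else 0) =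
      (((1 / 2 * ∑ i, ∑ j, (if i ≠ j then bx i j * ((l i : ℚ) * (l j : ℚ)) else 0) : ℚ) : ℝ) : ℂ) := by
    rw [Complex.ofReal_ratCast, Rat.cast_mul, Rat.cast_sum]
    congr 1
    · push_cast
      rfl
    · refine Finset.sum_congr rfl fun i _ => ?_
      rw [Rat.cast_sum]
      refine Finset.sum_congr rfl fun j _ => ?_
      split_ifs
      · push_cast
        rfl
      · rw [Rat.cast_zero]
  rw [hre, hκ, Complex.ofReal_re] at h
  rw [Rat.cast_add, Rat.cast_add, Rat.cast_sum]
  exact h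

/-- The locality shape of this file implies the pair-balanced locality of the groups producer
(`Model.deflator_form_le_on_singlet_orth_of_groups`): a group-local entry and a diagonal density pair
are both occupation-balanced. [folklore] -/
private theorem pairBalanced_of_localOrDensity {X : Type*} (grp : Fin k → X) (S : Model k)
    (hg : ∀ p q r s, S.eri p q r s ≠ 0 →
      (grp q = grp p ∧ grp r = grp p ∧ grp s = grp p) ∨ (q = p ∧ s = r)) :
    ∀ p q r s, S.eri p q r s ≠ 0 →
      (grp p = grp q ∧ grp r = grp s) ∨ (grp p = grp s ∧ grp r = grp q) := by
  intro p q r s hpqrs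
  rcases hg p q r s hpqrs with ⟨hq, hr, hs⟩ | ⟨hq, hs⟩
  · exact Or.inl ⟨hq.symm, hr.trans hs.symm⟩
  · exact Or.inl ⟨by rw [hq], by rw [hs]⟩

/-- **The block-deflator `hSform` from LOCAL + DENSITY premises.** As
`Model.deflator_form_le_on_singlet_orth_of_localBounds` (p497211) but for a deflator file whose
two-electron entries are group-local or diagonal density pairs with inter-group group-pair constants
`b×`; the finite occupation table carries the number polynomial:
`∀ l ≠ t, Σ l_i = 2n, l_i ≤ 2 m_i ⇒ S.ecore + Σ_i U_i(l_i) + ½ Σ_{i≠j} b×(i,j) l_i l_j ≤ c`. Conclusion =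
chem-type-09's `hSform` verbatim. [cite: HornJohnson2013, Cor. 4.3.9] -/
theorem Model.deflator_form_le_on_singlet_orth_of_localCrossBounds {X : Type*} [Fintype X]
    [DecidableEq X] (grp : Fin k → X) (m : X → ℕ) (φ : ∀ i, Fin (m i) ↪o Fin k)
    (hφ : ∀ i j, grp (φ i j) = i) (hcov : ∀ i p, grp p = i → ∃ j, φ i j = p) (S : Model k)
    (hh : ∀ p q, S.h p q ≠ 0 → grp q = grp p)
    (hg : ∀ p q r s, S.eri p q r s ≠ 0 →
      (grp q = grp p ∧ grp r = grp p ∧ grp s = grp p) ∨ (q = p ∧ s = r))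
    (bx : X → X → ℚ) (hx : ∀ p r, grp r ≠ grp p → S.eri p p r r = bx (grp p) (grp r))
    (U : X → ℕ → ℚ)
    (hU : ∀ i a b (χ : Fock (Orb (Fin (m i)))), IsInSector a b χ →
      (star χ ⬝ᵥ (S.restrict (φ i)).hamiltonian *ᵥ χ).re ≤ ((U i (a + b) : ℚ) : ℝ) * (star χ ⬝ᵥ χ).re)
    (t : X → ℕ) {c : ℚ} {n : ℕ} {u : Fock (Orb (Fin k))}
    (huT : ∀ s, (fun i => ∑ p ∈ upPart s, (if grp p = i then (1 : ℝ) else 0) +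
      ∑ p ∈ downPart s, (if grp p = i then (1 : ℝ) else 0)) ≠ (fun i => (t i : ℝ)) → u s = 0)
    (htab : ∀ l : X → ℕ, l ≠ t → (∑ i, l i) = n + n → (∀ i, l i ≤ 2 * m i) →
      S.ecore + ∑ i, U i (l i) +
        1 / 2 * ∑ i, ∑ j, (if i ≠ j then bx i j * ((l i : ℚ) * (l j : ℚ)) else 0) ≤ c)
    (htop : ∀ y : Fock (Orb (Fin k)), IsInSector n n y → spinPlus *ᵥ y = 0 →
      (∀ s, (fun i => ∑ p ∈ upPart s, (if grp p = i then (1 : ℝ) else 0) +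
        ∑ p ∈ downPart s, (if grp p = i then (1 : ℝ) else 0)) ≠ (fun i => (t i : ℝ)) → y s = 0) →
      star u ⬝ᵥ y = 0 →
      (star y ⬝ᵥ S.hamiltonian *ᵥ y).re ≤ ((c : ℚ) : ℝ) * (star y ⬝ᵥ y).re) :
    ∀ x : Fock (Orb (Fin k)), IsInSector n n x → spinPlus *ᵥ x = 0 → star u ⬝ᵥ x = 0 →
      (star x ⬝ᵥ S.hamiltonian *ᵥ x).re ≤ ((c : ℚ) : ℝ) * (star x ⬝ᵥ x).re := by
  refine Model.deflator_form_le_on_singlet_orth_of_groups grp S (fun p q hpq => (hh p q hpq).symm)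
    (pairBalanced_of_localOrDensity grp S hg) (fun i => (t i : ℝ)) huT (fun l hl z hz _ hsupp => ?_) htop
  -- `hoff` on the class `l ≠ t`, exactly as in the local sibling with the extended table
  by_cases h0 : z = 0
  · subst h0
    simp only [mulVec_zero, dotProduct_zero, Complex.zero_re, mul_zero, le_refl]
  obtain ⟨s₀, hs₀⟩ := Function.ne_iff.1 h0
  set lN : X → ℕ := fun i => ((upPart s₀).filter (fun p => grp p = i)).card +
    ((downPart s₀).filter (fun p => grp p = i)).card with hlN
  have hlab : ∀ s : Finset (Orb (Fin k)), (fun i => ∑ p ∈ upPart s, (if grp p = i then (1 : ℝ) else 0) +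
      ∑ p ∈ downPart s, (if grp p = i then (1 : ℝ) else 0)) =
      fun i => ((((upPart s).filter (fun p => grp p = i)).card +
        ((downPart s).filter (fun p => grp p = i)).card : ℕ) : ℝ) :=
    fun s => funext fun i => by rw [Finset.sum_boole, Finset.sum_boole, Nat.cast_add]
  have hl₀ : l = fun i => (lN i : ℝ) := by
    by_contra hne
    exact hs₀ (hsupp s₀ (by rw [hlab s₀]; exact fun h => hne (h.symm.trans rfl)))
  have hz' : ∀ s, (fun i => ((upPart s).filter (fun p => grp p = i)).card +
      ((downPart s).filter (fun p => grp p = i)).card) ≠ lN → z s = 0 := by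
    intro s hs
    refine hsupp s ?_
    rw [hlab s, hl₀]
    intro h
    exact hs (funext fun i => Nat.cast_injective (R := ℝ) (congrFun h i))
  have hform := Model.form_le_of_localCrossBounds grp m φ hφ hcov S hh hg bx hx U hU lN z hz'
  have hlt : lN ≠ t := fun h => hl (by rw [hl₀, h])
  have hsum : (∑ i, lN i) = n + n := sum_grp_occupation_eq grp hz hs₀
  have hcap : ∀ i, lN i ≤ 2 * m i := fun i => grp_occupation_le grp m φ hφ hcov i s₀
  have htab' : ((S.ecore + ∑ i, U i (lN i) +
      1 / 2 * ∑ i, ∑ j, (if i ≠ j then bx i j * ((lN i : ℚ) * (lN j : ℚ)) else 0) : ℚ) : ℝ) ≤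
      ((c : ℚ) : ℝ) :=
    Rat.cast_le.2 (htab lN hlt hsum hcap)
  have hzz : 0 ≤ (star z ⬝ᵥ z).re := (Complex.nonneg_iff.1 (dotProduct_star_self_nonneg z)).1
  exact hform.trans (mul_le_mul_of_nonneg_right htab' hzz)

/-- **(n1)+(n2)+(n3) ⇒ (G) with LOCAL + DENSITY premises**, sector `LowerRow` leg of the exact
combined file `Model.lincomb 1 λ F S`, `0 ≤ λ` ⟹ `SingletGapCertificateCodimOne F n (ℓ − λc)`
(chem-type-09's `singletGapCertificateCodimOne_of_lowerRow_shift`). [cite: HornJohnson2013, Cor. 4.3.9] -/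
theorem Model.singletGapCertificateCodimOne_of_localCrossDeflator {X : Type*} [Fintype X]
    [DecidableEq X] (grp : Fin k → X) (m : X → ℕ) (φ : ∀ i, Fin (m i) ↪o Fin k)
    (hφ : ∀ i j, grp (φ i j) = i) (hcov : ∀ i p, grp p = i → ∃ j, φ i j = p) {F S : Model k}
    (hF : F.IsSymmetric) (hS : S.IsSymmetric)
    (hh : ∀ p q, S.h p q ≠ 0 → grp q = grp p)
    (hg : ∀ p q r s, S.eri p q r s ≠ 0 →
      (grp q = grp p ∧ grp r = grp p ∧ grp s = grp p) ∨ (q = p ∧ s = r))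
    (bx : X → X → ℚ) (hx : ∀ p r, grp r ≠ grp p → S.eri p p r r = bx (grp p) (grp r))
    (U : X → ℕ → ℚ)
    (hU : ∀ i a b (χ : Fock (Orb (Fin (m i)))), IsInSector a b χ →
      (star χ ⬝ᵥ (S.restrict (φ i)).hamiltonian *ᵥ χ).re ≤ ((U i (a + b) : ℚ) : ℝ) * (star χ ⬝ᵥ χ).re)
    (t : X → ℕ) {c : ℚ} {n : ℕ} {u : Fock (Orb (Fin k))}
    (huT : ∀ s, (fun i => ∑ p ∈ upPart s, (if grp p = i then (1 : ℝ) else 0) +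
      ∑ p ∈ downPart s, (if grp p = i then (1 : ℝ) else 0)) ≠ (fun i => (t i : ℝ)) → u s = 0)
    (htab : ∀ l : X → ℕ, l ≠ t → (∑ i, l i) = n + n → (∀ i, l i ≤ 2 * m i) →
      S.ecore + ∑ i, U i (l i) +
        1 / 2 * ∑ i, ∑ j, (if i ≠ j then bx i j * ((l i : ℚ) * (l j : ℚ)) else 0) ≤ c)
    (htop : ∀ y : Fock (Orb (Fin k)), IsInSector n n y → spinPlus *ᵥ y = 0 →
      (∀ s, (fun i => ∑ p ∈ upPart s, (if grp p = i then (1 : ℝ) else 0) +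
        ∑ p ∈ downPart s, (if grp p = i then (1 : ℝ) else 0)) ≠ (fun i => (t i : ℝ)) → y s = 0) →
      star u ⬝ᵥ y = 0 →
      (star y ⬝ᵥ S.hamiltonian *ᵥ y).re ≤ ((c : ℚ) : ℝ) * (star y ⬝ᵥ y).re)
    {lam : ℚ} (hlam : 0 ≤ lam) {ℓ : ℚ} (hL : LowerRow (Model.lincomb 1 lam F S) n n ℓ) :
    SingletGapCertificateCodimOne F n (ℓ - lam * c) :=
  singletGapCertificateCodimOne_of_lowerRow_shift hF hS hlam u
    (Model.deflator_form_le_on_singlet_orth_of_localCrossBounds grp m φ hφ hcov S hh hg bx hx U hU t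
      huT htab htop) hL

/-- The same with the SINGLET lower row of the combined file as the leg (`:s2=0` kind; the flip leg of
RC.205 enters here). [cite: HornJohnson2013, Cor. 4.3.9] -/
theorem Model.singletGapCertificateCodimOne_of_localCrossDeflator_singlet {X : Type*} [Fintype X]
    [DecidableEq X] (grp : Fin k → X) (m : X → ℕ) (φ : ∀ i, Fin (m i) ↪o Fin k)
    (hφ : ∀ i j, grp (φ i j) = i) (hcov : ∀ i p, grp p = i → ∃ j, φ i j = p) {F S : Model k}
    (hF : F.IsSymmetric) (hS : S.IsSymmetric)
    (hh : ∀ p q, S.h p q ≠ 0 → grp q = grp p)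
    (hg : ∀ p q r s, S.eri p q r s ≠ 0 →
      (grp q = grp p ∧ grp r = grp p ∧ grp s = grp p) ∨ (q = p ∧ s = r))
    (bx : X → X → ℚ) (hx : ∀ p r, grp r ≠ grp p → S.eri p p r r = bx (grp p) (grp r))
    (U : X → ℕ → ℚ)
    (hU : ∀ i a b (χ : Fock (Orb (Fin (m i)))), IsInSector a b χ →
      (star χ ⬝ᵥ (S.restrict (φ i)).hamiltonian *ᵥ χ).re ≤ ((U i (a + b) : ℚ) : ℝ) * (star χ ⬝ᵥ χ).re)
    (t : X → ℕ) {c : ℚ} {n : ℕ} {u : Fock (Orb (Fin k))}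
    (huT : ∀ s, (fun i => ∑ p ∈ upPart s, (if grp p = i then (1 : ℝ) else 0) +
      ∑ p ∈ downPart s, (if grp p = i then (1 : ℝ) else 0)) ≠ (fun i => (t i : ℝ)) → u s = 0)
    (htab : ∀ l : X → ℕ, l ≠ t → (∑ i, l i) = n + n → (∀ i, l i ≤ 2 * m i) →
      S.ecore + ∑ i, U i (l i) +
        1 / 2 * ∑ i, ∑ j, (if i ≠ j then bx i j * ((l i : ℚ) * (l j : ℚ)) else 0) ≤ c)
    (htop : ∀ y : Fock (Orb (Fin k)), IsInSector n n y → spinPlus *ᵥ y = 0 →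
      (∀ s, (fun i => ∑ p ∈ upPart s, (if grp p = i then (1 : ℝ) else 0) +
        ∑ p ∈ downPart s, (if grp p = i then (1 : ℝ) else 0)) ≠ (fun i => (t i : ℝ)) → y s = 0) →
      star u ⬝ᵥ y = 0 →
      (star y ⬝ᵥ S.hamiltonian *ᵥ y).re ≤ ((c : ℚ) : ℝ) * (star y ⬝ᵥ y).re)
    {lam : ℚ} (hlam : 0 ≤ lam) {ℓ : ℚ} (hL : SingletLowerRow (Model.lincomb 1 lam F S) n ℓ) :
    SingletGapCertificateCodimOne F n (ℓ - lam * c) :=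
  singletGapCertificateCodimOne_of_singletLowerRow_shift hF hS hlam u
    (Model.deflator_form_le_on_singlet_orth_of_localCrossBounds grp m φ hφ hcov S hh hg bx hx U hU t
      huT htab htop) hL

/-! ## Spin-penalty SECTOR form of the top-class premise (as in the local sibling, p497812) -/

/-- **`hSform` from LOCAL + DENSITY premises with the top class certified in spin-penalty SECTOR form**
(`htopPen`: for some `μ : ℂ`, `ν : ℝ`, every `(n, n)`-sector vector `y` of the top class satisfies
`Re⟨y, (Ĥ(S) − μ Ŝ₊ᴴŜ₊) y⟩ ≤ c‖y‖² + ν |⟨u, y⟩|²`; `htop_of_spinPenalty ∘ htop_of_rankOne`, p497446).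
[cite: HornJohnson2013, Cor. 4.3.9] -/
theorem Model.deflator_form_le_on_singlet_orth_of_localCrossBounds_spinPenalty {X : Type*} [Fintype X]
    [DecidableEq X] (grp : Fin k → X) (m : X → ℕ) (φ : ∀ i, Fin (m i) ↪o Fin k)
    (hφ : ∀ i j, grp (φ i j) = i) (hcov : ∀ i p, grp p = i → ∃ j, φ i j = p) (S : Model k)
    (hh : ∀ p q, S.h p q ≠ 0 → grp q = grp p)
    (hg : ∀ p q r s, S.eri p q r s ≠ 0 →
      (grp q = grp p ∧ grp r = grp p ∧ grp s = grp p) ∨ (q = p ∧ s = r))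
    (bx : X → X → ℚ) (hx : ∀ p r, grp r ≠ grp p → S.eri p p r r = bx (grp p) (grp r))
    (U : X → ℕ → ℚ)
    (hU : ∀ i a b (χ : Fock (Orb (Fin (m i)))), IsInSector a b χ →
      (star χ ⬝ᵥ (S.restrict (φ i)).hamiltonian *ᵥ χ).re ≤ ((U i (a + b) : ℚ) : ℝ) * (star χ ⬝ᵥ χ).re)
    (t : X → ℕ) {c : ℚ} {n : ℕ} {u : Fock (Orb (Fin k))}
    (huT : ∀ s, (fun i => ∑ p ∈ upPart s, (if grp p = i then (1 : ℝ) else 0) +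
      ∑ p ∈ downPart s, (if grp p = i then (1 : ℝ) else 0)) ≠ (fun i => (t i : ℝ)) → u s = 0)
    (htab : ∀ l : X → ℕ, l ≠ t → (∑ i, l i) = n + n → (∀ i, l i ≤ 2 * m i) →
      S.ecore + ∑ i, U i (l i) +
        1 / 2 * ∑ i, ∑ j, (if i ≠ j then bx i j * ((l i : ℚ) * (l j : ℚ)) else 0) ≤ c)
    (μ : ℂ) (ν : ℝ)
    (htopPen : ∀ y : Fock (Orb (Fin k)), IsInSector n n y →
      (∀ s, (fun i => ∑ p ∈ upPart s, (if grp p = i then (1 : ℝ) else 0) +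
        ∑ p ∈ downPart s, (if grp p = i then (1 : ℝ) else 0)) ≠ (fun i => (t i : ℝ)) → y s = 0) →
      (star y ⬝ᵥ (S.hamiltonian - μ • (spinPlusᴴ * spinPlus)) *ᵥ y).re ≤
        ((c : ℚ) : ℝ) * (star y ⬝ᵥ y).re + ν * ‖star u ⬝ᵥ y‖ ^ 2) :
    ∀ x : Fock (Orb (Fin k)), IsInSector n n x → spinPlus *ᵥ x = 0 → star u ⬝ᵥ x = 0 →
      (star x ⬝ᵥ S.hamiltonian *ᵥ x).re ≤ ((c : ℚ) : ℝ) * (star x ⬝ᵥ x).re :=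
  Model.deflator_form_le_on_singlet_orth_of_localCrossBounds grp m φ hφ hcov S hh hg bx hx U hU t huT
    htab (htop_of_spinPenalty μ (htop_of_rankOne htopPen))

/-- **(G) with LOCAL + DENSITY premises and the spin-penalty top-class certificate**, sector
`LowerRow` leg of `Model.lincomb 1 λ F S`. [cite: HornJohnson2013, Cor. 4.3.9] -/
theorem Model.singletGapCertificateCodimOne_of_localCrossDeflator_spinPenalty {X : Type*} [Fintype X]
    [DecidableEq X] (grp : Fin k → X) (m : X → ℕ) (φ : ∀ i, Fin (m i) ↪o Fin k)
    (hφ : ∀ i j, grp (φ i j) = i) (hcov : ∀ i p, grp p = i → ∃ j, φ i j = p) {F S : Model k}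
    (hF : F.IsSymmetric) (hS : S.IsSymmetric)
    (hh : ∀ p q, S.h p q ≠ 0 → grp q = grp p)
    (hg : ∀ p q r s, S.eri p q r s ≠ 0 →
      (grp q = grp p ∧ grp r = grp p ∧ grp s = grp p) ∨ (q = p ∧ s = r))
    (bx : X → X → ℚ) (hx : ∀ p r, grp r ≠ grp p → S.eri p p r r = bx (grp p) (grp r))
    (U : X → ℕ → ℚ)
    (hU : ∀ i a b (χ : Fock (Orb (Fin (m i)))), IsInSector a b χ →
      (star χ ⬝ᵥ (S.restrict (φ i)).hamiltonian *ᵥ χ).re ≤ ((U i (a + b) : ℚ) : ℝ) * (star χ ⬝ᵥ χ).re)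
    (t : X → ℕ) {c : ℚ} {n : ℕ} {u : Fock (Orb (Fin k))}
    (huT : ∀ s, (fun i => ∑ p ∈ upPart s, (if grp p = i then (1 : ℝ) else 0) +
      ∑ p ∈ downPart s, (if grp p = i then (1 : ℝ) else 0)) ≠ (fun i => (t i : ℝ)) → u s = 0)
    (htab : ∀ l : X → ℕ, l ≠ t → (∑ i, l i) = n + n → (∀ i, l i ≤ 2 * m i) →
      S.ecore + ∑ i, U i (l i) +
        1 / 2 * ∑ i, ∑ j, (if i ≠ j then bx i j * ((l i : ℚ) * (l j : ℚ)) else 0) ≤ c)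
    (μ : ℂ) (ν : ℝ)
    (htopPen : ∀ y : Fock (Orb (Fin k)), IsInSector n n y →
      (∀ s, (fun i => ∑ p ∈ upPart s, (if grp p = i then (1 : ℝ) else 0) +
        ∑ p ∈ downPart s, (if grp p = i then (1 : ℝ) else 0)) ≠ (fun i => (t i : ℝ)) → y s = 0) →
      (star y ⬝ᵥ (S.hamiltonian - μ • (spinPlusᴴ * spinPlus)) *ᵥ y).re ≤
        ((c : ℚ) : ℝ) * (star y ⬝ᵥ y).re + ν * ‖star u ⬝ᵥ y‖ ^ 2)
    {lam : ℚ} (hlam : 0 ≤ lam) {ℓ : ℚ} (hL : LowerRow (Model.lincomb 1 lam F S) n n ℓ) :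
    SingletGapCertificateCodimOne F n (ℓ - lam * c) :=
  singletGapCertificateCodimOne_of_lowerRow_shift hF hS hlam u
    (Model.deflator_form_le_on_singlet_orth_of_localCrossBounds_spinPenalty grp m φ hφ hcov S hh hg bx
      hx U hU t huT htab μ ν htopPen) hL

/-- The same with the SINGLET lower row of the combined file as the leg. [cite: HornJohnson2013, Cor. 4.3.9] -/
theorem Model.singletGapCertificateCodimOne_of_localCrossDeflator_spinPenalty_singlet {X : Type*}
    [Fintype X] [DecidableEq X] (grp : Fin k → X) (m : X → ℕ) (φ : ∀ i, Fin (m i) ↪o Fin k)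
    (hφ : ∀ i j, grp (φ i j) = i) (hcov : ∀ i p, grp p = i → ∃ j, φ i j = p) {F S : Model k}
    (hF : F.IsSymmetric) (hS : S.IsSymmetric)
    (hh : ∀ p q, S.h p q ≠ 0 → grp q = grp p)
    (hg : ∀ p q r s, S.eri p q r s ≠ 0 →
      (grp q = grp p ∧ grp r = grp p ∧ grp s = grp p) ∨ (q = p ∧ s = r))
    (bx : X → X → ℚ) (hx : ∀ p r, grp r ≠ grp p → S.eri p p r r = bx (grp p) (grp r))
    (U : X → ℕ → ℚ)
    (hU : ∀ i a b (χ : Fock (Orb (Fin (m i)))), IsInSector a b χ →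
      (star χ ⬝ᵥ (S.restrict (φ i)).hamiltonian *ᵥ χ).re ≤ ((U i (a + b) : ℚ) : ℝ) * (star χ ⬝ᵥ χ).re)
    (t : X → ℕ) {c : ℚ} {n : ℕ} {u : Fock (Orb (Fin k))}
    (huT : ∀ s, (fun i => ∑ p ∈ upPart s, (if grp p = i then (1 : ℝ) else 0) +
      ∑ p ∈ downPart s, (if grp p = i then (1 : ℝ) else 0)) ≠ (fun i => (t i : ℝ)) → u s = 0)
    (htab : ∀ l : X → ℕ, l ≠ t → (∑ i, l i) = n + n → (∀ i, l i ≤ 2 * m i) →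
      S.ecore + ∑ i, U i (l i) +
        1 / 2 * ∑ i, ∑ j, (if i ≠ j then bx i j * ((l i : ℚ) * (l j : ℚ)) else 0) ≤ c)
    (μ : ℂ) (ν : ℝ)
    (htopPen : ∀ y : Fock (Orb (Fin k)), IsInSector n n y →
      (∀ s, (fun i => ∑ p ∈ upPart s, (if grp p = i then (1 : ℝ) else 0) +
        ∑ p ∈ downPart s, (if grp p = i then (1 : ℝ) else 0)) ≠ (fun i => (t i : ℝ)) → y s = 0) →
      (star y ⬝ᵥ (S.hamiltonian - μ • (spinPlusᴴ * spinPlus)) *ᵥ y).re ≤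
        ((c : ℚ) : ℝ) * (star y ⬝ᵥ y).re + ν * ‖star u ⬝ᵥ y‖ ^ 2)
    {lam : ℚ} (hlam : 0 ≤ lam) {ℓ : ℚ} (hL : SingletLowerRow (Model.lincomb 1 lam F S) n ℓ) :
    SingletGapCertificateCodimOne F n (ℓ - lam * c) :=
  singletGapCertificateCodimOne_of_singletLowerRow_shift hF hS hlam u
    (Model.deflator_form_le_on_singlet_orth_of_localCrossBounds_spinPenalty grp m φ hφ hcov S hh hg bx
      hx U hU t huT htab μ ν htopPen) hL

end Summit.Ventures.CertifiedQuantumChemistry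

end
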